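import Summits.HubbardSuperconductivity.HubbardSuperconductivity.Theorems.AnisotropyChordSpinTowerProperPosition

/-!
# Route `AnisotropyChord`: SECTOR PERRON–FROBENIUS FOR EVERY SPIN — the spin-`n/2` XXZ Hamiltonian on a
# graph with connected copy blow-up has, in every non-trivial magnetisation sector and for every `Δ`, a
# unique (up to scale) sector ground state, which can be chosen entrywise real non-negative
# (transfer of `xxz_sector_perron_pos` through the blow-up isometry; theory seat memo ROTOR-THEORY-6 §72)

* `xxzSpin_sector_perron` — existence (`χ₀ = Jᴴ ψ₀` for the positive Perron vector `ψ₀` of the blow-up),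
  realness/non-negativity, the eigen-equation at the sector energy, and UNIQUENESS: every sector ground
  state `χ` is a multiple of `χ₀` (`Jχ` is a sector ground state of the blow-up by the intertwining and
  `lowestEnergy_blowUp_eq`, hence a multiple of `ψ₀`; apply `Jᴴ`).
* `xxzSpin_sector_perron_of_connected` — the same for `G` connected on a non-trivial vertex set, `n ≥ 1`.

Tasaki (2020) §2.2, §4.1 (Perron–Frobenius for stoquastic spin Hamiltonians).  No definition is introduced.
-/

set_option linter.dupNamespace false

noncomputable section

namespace Summit.HubbardSuperconductivity.HubbardSuperconductivity.Theorems.AnisotropyChord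

open Matrix Complex Finset
open Literature.MathematicalPhysics.QuantumLattice

variable {V : Type} [Fintype V] [DecidableEq V]

/-- **Sector Perron–Frobenius for the spin-`n/2` XXZ Hamiltonian** (`xxzHamiltonian n G (−1) Δ`, any `Δ`,
copy blow-up connected, sector `M` non-trivial): there is a non-zero, entrywise real non-negative sector
ground state `χ₀`, and every sector ground state is a scalar multiple of it. [folklore] -/
theorem xxzSpin_sector_perron (n : ℕ) (G : SimpleGraph V) [DecidableRel G.Adj]
    (hG' : (blowUpGraph n G).Connected) (Δ : ℝ) {M : ℝ} (hK : spinZSector (Λ := V) n M ≠ ⊥) :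
    ∃ χ₀ : (V → Fin (n + 1)) → ℂ,
      χ₀ ∈ spinZSector (Λ := V) n M ∧ χ₀ ≠ 0 ∧ (∀ k, 0 ≤ (χ₀ k).re ∧ (χ₀ k).im = 0) ∧
      xxzHamiltonian n G (-1) Δ *ᵥ χ₀ =
        ((lowestEnergyInSector n (xxzHamiltonian n G (-1) Δ) M : ℝ) : ℂ) • χ₀ ∧
      ∀ χ : (V → Fin (n + 1)) → ℂ, χ ∈ spinZSector (Λ := V) n M →
        xxzHamiltonian n G (-1) Δ *ᵥ χ =
          ((lowestEnergyInSector n (xxzHamiltonian n G (-1) Δ) M : ℝ) : ℂ) • χ →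
        ∃ c : ℂ, χ = c • χ₀ := by
  set J : Matrix (V × Fin n → Fin 2) (V → Fin (n + 1)) ℂ := blowUpIso n with hJ
  set H' : Matrix (V × Fin n → Fin 2) (V × Fin n → Fin 2) ℂ := xxzHamiltonian 1 (blowUpGraph n G) (-1) Δ
    with hH'
  set HS : Matrix (V → Fin (n + 1)) (V → Fin (n + 1)) ℂ := xxzHamiltonian n G (-1) Δ with hHS
  have hE : lowestEnergyInSector n HS M = lowestEnergyInSector 1 H' M := lowestEnergy_blowUp_eq n G Δ hK
  -- the blow-up's sector `M` is a non-trivial weight sector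
  obtain ⟨W, hWatt, hMW⟩ := exists_weight_of_sector_ne_bot (blowUp_sector_ne_bot n hK)
  obtain ⟨ψ₀, hψ₀K, hψ₀0, hψ₀nn, hψ₀pos, -, hHψ₀, huniq⟩ :=
    xxz_sector_perron_pos (blowUpGraph n G) hG' Δ W hWatt
  rw [← hMW] at hψ₀K hHψ₀ huniq
  -- the candidate `χ₀ = Jᴴ ψ₀`
  refine ⟨Jᴴ *ᵥ ψ₀, blowUpIso_conjTranspose_mulVec_mem n hψ₀K, ?_, ?_, ?_, ?_⟩
  · -- non-zero: the fibre sum at the counts of a configuration carrying `ψ₀` is positive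
    obtain ⟨τ₀, hτ₀⟩ := Function.ne_iff.mp hψ₀0
    intro h0
    have h1 : (Jᴴ *ᵥ ψ₀) (blowUpCount n τ₀) = 0 := by rw [h0]; rfl
    rw [hJ, blowUpIso_conjTranspose_mulVec_apply] at h1
    rcases mul_eq_zero.1 h1 with h2 | h2
    · exact (inv_ne_zero (Real.sqrt_ne_zero'.mpr (blowUpFibreCard_pos n _))) (Complex.ofReal_eq_zero.1 h2)
    · have hre : (∑ τ ∈ Finset.univ.filter (fun τ : V × Fin n → Fin 2 => blowUpCount n τ = blowUpCount n τ₀),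
          ψ₀ τ).re = 0 := by rw [h2, Complex.zero_re]
      rw [Complex.re_sum] at hre
      have hle : ∀ τ ∈ Finset.univ.filter (fun τ : V × Fin n → Fin 2 => blowUpCount n τ = blowUpCount n τ₀),
          0 ≤ (ψ₀ τ).re := fun τ _ => (hψ₀nn τ).1
      have h3 := (Finset.sum_eq_zero_iff_of_nonneg hle).1 hre τ₀
        (Finset.mem_filter.2 ⟨Finset.mem_univ _, rfl⟩)
      apply hτ₀
      exact Complex.ext (by rw [h3]; rfl) (by rw [(hψ₀nn τ₀).2]; rfl)
  · -- entrywise real non-negative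
    intro k
    rw [hJ, blowUpIso_conjTranspose_mulVec_apply]
    have hc : 0 ≤ (Real.sqrt (blowUpFibreCard n k))⁻¹ := inv_nonneg.mpr (Real.sqrt_nonneg _)
    constructor
    · rw [Complex.re_ofReal_mul, Complex.re_sum]
      exact mul_nonneg hc (Finset.sum_nonneg fun τ _ => (hψ₀nn τ).1)
    · rw [Complex.im_ofReal_mul, Complex.im_sum, Finset.sum_eq_zero (fun τ _ => (hψ₀nn τ).2), mul_zero]
  · -- eigen-equation
    rw [Matrix.mulVec_mulVec, hHS, hJ, xxz_mul_blowUpIso_conjTranspose, ← Matrix.mulVec_mulVec, ← hH', hHψ₀,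
      Matrix.mulVec_smul, ← hHS, hE]
  · -- uniqueness
    intro χ hχK hHχ
    have hJχK : J *ᵥ χ ∈ spinZSector (Λ := V × Fin n) 1 M := blowUpIso_mulVec_mem n hχK
    have hHJχ : H' *ᵥ (J *ᵥ χ) = ((lowestEnergyInSector 1 H' M : ℝ) : ℂ) • (J *ᵥ χ) := by
      rw [Matrix.mulVec_mulVec, hH', hJ, blowUp_xxzHamiltonian_mul_blowUpIso, ← Matrix.mulVec_mulVec, ← hHS,
        hHχ, Matrix.mulVec_smul, hE]
    obtain ⟨c, hc⟩ := huniq (J *ᵥ χ) hJχK hHJχ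
    refine ⟨c, ?_⟩
    have h1 : χ = Jᴴ *ᵥ (J *ᵥ χ) := by
      rw [Matrix.mulVec_mulVec, hJ, blowUpIso_conjTranspose_mul_self, Matrix.one_mulVec]
    rw [h1, hc, Matrix.mulVec_smul]

/-- **Sector Perron–Frobenius for every spin on connected graphs** (`n ≥ 1`, non-trivial vertex set).
[folklore] -/
theorem xxzSpin_sector_perron_of_connected (n : ℕ) (hn : 0 < n) (G : SimpleGraph V) [DecidableRel G.Adj]
    [Nontrivial V] (hG : G.Connected) (Δ : ℝ) {M : ℝ} (hK : spinZSector (Λ := V) n M ≠ ⊥) :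
    ∃ χ₀ : (V → Fin (n + 1)) → ℂ,
      χ₀ ∈ spinZSector (Λ := V) n M ∧ χ₀ ≠ 0 ∧ (∀ k, 0 ≤ (χ₀ k).re ∧ (χ₀ k).im = 0) ∧
      xxzHamiltonian n G (-1) Δ *ᵥ χ₀ =
        ((lowestEnergyInSector n (xxzHamiltonian n G (-1) Δ) M : ℝ) : ℂ) • χ₀ ∧
      ∀ χ : (V → Fin (n + 1)) → ℂ, χ ∈ spinZSector (Λ := V) n M →
        xxzHamiltonian n G (-1) Δ *ᵥ χ =
          ((lowestEnergyInSector n (xxzHamiltonian n G (-1) Δ) M : ℝ) : ℂ) • χ →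
        ∃ c : ℂ, χ = c • χ₀ :=
  xxzSpin_sector_perron n G (blowUpGraph_connected n hn G hG) Δ hK

end Summit.HubbardSuperconductivity.HubbardSuperconductivity.Theorems.AnisotropyChord
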